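/-
Copyright (c) 2026 the pub-hodgecm-mathlib formalisation cell (harness21).  Prover seat hodgecm-mathlib-K2Liu-p13 (g2), Track B «K2-LIT»,
#184♮ = hLiu418 = `stmt-HodgeConjecture-24832`; Road I v3 organ U1-CT-ind STAGE 2 (Q2), file F5-l (payer of ★ F5-e's binder `hfib`).
-/
import Summits.HodgeConjecture.HodgeConjecture.Theorems.K2LiuCoveringWeightFibreIntegration   -- ★ F5-e: `lintegral_fibre_eq_of_coveringSum_eq_one` (+ ★ F5-c)
import Summits.HodgeConjecture.HodgeConjecture.Theorems.K2LiuKlingenUnipotentAdelicChart       -- ★ F5-i: `continuous_klingenChart`, `klingenChart_mul` (+ ★ F4-1, F4-0)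
import HarnessLib

/-!
# Crux `HLiu418`, Road I v3, organ U1 stage 2 (Q2), file F5-l: THE FIBRE MASS `∫ β₁(Ψ(u₊(z)) · n′) dμ_Z(z)` IS THE SAME ON EVERY FIBRE —
# the `u₊(L⁺)`-covering weight restricted to the cosets `u₊(𝔸)·n′` (payer of ★ F5-e `klingenInner_eq_mul_integral_fibre`'s `hfib`)

Cell `hodgecm-mathlib`, crux item hLiu418 = `stmt-HodgeConjecture-24832`; squad K2 ∕ K2Liu; LEAD F0P6-plan (g14), co-dealer K2E5-plan (g7); prover K2Liu-p13 (g2).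
THEOREMS ONLY (no `def`, no instance, no notation, no named-fact hypothesis, no `sorry`); lane `--supports stmt-HodgeConjecture-24832 --as helper` (count-neutral).
SETTING (`n = 2`, transport clause (T1) BY VALUE, chart `Φ(z; y, t) = Ψ(n_Q(y,z,t))` of ★ F5-i).  `Γ₁ ≤ N_Q(𝔸)` is the stabiliser lattice of the `ξ`-cell and `Λ ≤ 𝔸_L`
its additive shadow, linked BY NAME: `hΓΛ : γ ∈ Γ₁ ↔ ∃ l ∈ Λ, ↑γ = Ψ(u₊(l))` (for the consumer: `Γ₁ = Ψ(u₊(L⁺… L))` by ★ F4-3b `isSiegelDelta_conj_transport_iff_exists_uPlus`,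
`Λ = ι(L)`); `β₁` a `Γ₁`-covering weight; `μ_Z` ANY left-invariant measure on `𝔸_L`.
* `transport_uPlus_mul_klingenChart` — `Ψ(u₊(l)) · Φ(z; y, t) = Φ(l + z; y, t)` (★ F5-i `klingenChart_mul` at `p₀ = (l; 0, 0)`);
* `coveringSum_fibre_eq_one` — along each fibre, `z ↦ β₁(Φ(z; y, t))` is a `Λ`-covering weight on `𝔸_L` (the additive lattice acting through Mathlib's
  `Multiplicative Λ`; bijection `Λ ≃ Γ₁`, `l ↦ Ψ(u₊(l))`);
* **`lintegral_fibre_klingenChart_eq`** — `∫⁻ β₁(Φ(z,p)) dμ_Z = ∫⁻ β₁(Φ(z,p₀)) dμ_Z` for all `p, p₀` (★ `lintegral_mul_eq_of_coveringSum_eq` with `F = 1`, as in ★ F5-e §2);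
* **`lintegral_fibre_klingenChart_eq_of_weight`** — `= ∫⁻ β₀ dμ_Z` for ANY measurable `Λ`-covering weight `β₀` on `𝔸_L` (so `hfib` holds with `C = ∫ β₀ < ∞` as soon as ONE weight of
  finite mass exists: `L\𝔸_L` compact).
[Weil1965, §9, §37], [MoeglinWaldspurger1995, I.2.1, II.1.7], [CogdellAnalyticTheory2004, §2.3].
HONEST LABEL.  Count-neutral helper: `HC_CM` is proved only modulo the 7 printed citations (2 remaining named inputs: hLiu418 = `stmt-HodgeConjecture-24832`,
h413 = `stmt-HodgeConjecture-24833`) until rung 0 closes.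
-/

set_option autoImplicit false
set_option linter.dupNamespace false -- the mandated namespace repeats `HodgeConjecture.HodgeConjecture`

noncomputable section

open scoped Matrix ENNReal NNReal
open NumberField IsDedekindDomain MeasureTheory MeasureTheory.Measure Function

namespace Summit.HodgeConjecture.HodgeConjecture.Cruxes.HLiu418.K2LiuKlingenFibreMassConstant

open Literature.MeasureTheory.Group
open Literature.NumberTheory.Automorphic Literature.NumberTheory.Automorphic.UnitaryGroup
open Literature.NumberTheory.GelbartRogawski1991 Literature.NumberTheory.GelbartRogawski1991.GRConstruction
open Literature.NumberTheory.K2Lit.SiegelDoubled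
open Summit.HodgeConjecture.HodgeConjecture.Cruxes.HLiu418.K2LiuDoubledUTwoTwoBorelFrame
open Summit.HodgeConjecture.HodgeConjecture.Cruxes.HLiu418.K2LiuKlingenParabolicDefs
open Summit.HodgeConjecture.HodgeConjecture.Cruxes.HLiu418.K2LiuKlingenUnipotentDefs
open Summit.HodgeConjecture.HodgeConjecture.Cruxes.HLiu418.K2LiuKlingenUnipotentAdelicDefs
open Summit.HodgeConjecture.HodgeConjecture.Cruxes.HLiu418.K2LiuKlingenUnipotentAdelicChart
open Summit.HodgeConjecture.HodgeConjecture.Cruxes.HLiu418.K2LiuKlingenInnerSectionLeviLaw (nKlingen_congr)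
open Summit.HodgeConjecture.HodgeConjecture.Cruxes.HLiu418.K2LiuSiegelDoubledLeviMatrix (conjAdele_conjAdele')
open UnitaryDualPair

variable {L : Type} [Field L] [NumberField L] [IsCMField L]
variable {N M : ℕ} {e : Fin N × Fin M ≃ Fin 2}
  {dV : Fin N → L} {hdV : ∀ i, IsCMField.complexConj L (dV i) = dV i}
  {dW : Fin M → L} {hdW : ∀ i, IsCMField.complexConj L (dW i) = dW i}

/-- **`Ψ(u₊(l)) · Φ(z; y, t) = Φ(l + z; y, t)`** (★ F5-i `klingenChart_mul` at `p₀ = (l; 0, 0)`, `u₊(l) = n_Q(0,l,0)`). [cite: Xiong2013, §7 Lemma 7.1] -/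
theorem transport_uPlus_mul_klingenChart (Ψ : (quasiSplit (Fp L) L (IsCMField.complexConj L) (2 + 2)).Adelic ≃ₜ* HA L e dV hdV dW hdW)
    (Y : AddSubgroup (AdeleRing (𝓞 L) L)) (hY : ∀ y, y ∈ Y ↔ conjAdele (Fp L) L (IsCMField.complexConj L) y = -y) (l z : AdeleRing (𝓞 L) L) (p : ↥Y × AdeleRing (𝓞 L) L) :
    Ψ (jAdelic L 4 (uPlus (AdeleRing (𝓞 L) L) (conjAdele (Fp L) L (IsCMField.complexConj L)) (conjAdele_conjAdele' L) (l))) * (((⟨Ψ (jAdelic L 4 (nKlingen (AdeleRing (𝓞 L) L) (conjAdele (Fp L) L (IsCMField.complexConj L)) (conjAdele_conjAdele' L)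
            ((p).1 : AdeleRing (𝓞 L) L) ((hY _).1 (p).1.2) (z) (p).2)), transport_nKlingen_mem Ψ _ _ _ _⟩ : ↥(klingenUnipA Ψ))) : HA L e dV hdV dW hdW) = (((⟨Ψ (jAdelic L 4 (nKlingen (AdeleRing (𝓞 L) L) (conjAdele (Fp L) L (IsCMField.complexConj L)) (conjAdele_conjAdele' L)
            ((p).1 : AdeleRing (𝓞 L) L) ((hY _).1 (p).1.2) (l + z) (p).2)), transport_nKlingen_mem Ψ _ _ _ _⟩ : ↥(klingenUnipA Ψ))) : HA L e dV hdV dW hdW) := by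
  have h1 : (0 : AdeleRing (𝓞 L) L) + (p.1 : AdeleRing (𝓞 L) L) +
      (z * conjAdele (Fp L) L (IsCMField.complexConj L) 0 - 0 * conjAdele (Fp L) L (IsCMField.complexConj L) z) = (p.1 : AdeleRing (𝓞 L) L) := by
    rw [map_zero, mul_zero, zero_mul, sub_self, add_zero, zero_add]
  have h3 : (0 : AdeleRing (𝓞 L) L) + p.2 = p.2 := zero_add _
  change Ψ _ * Ψ _ = Ψ _
  rw [← map_mul, ← map_mul, uPlus_eq_nKlingen (conjAdele_conjAdele' L), nKlingen_mul]
  exact congrArg Ψ (congrArg (jAdelic L 4) (nKlingen_congr (conjAdele_conjAdele' L) h1 rfl h3))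

section Transport

variable {SA : GL (Fin (2 + 2)) (AdeleRing (𝓞 L) L)}
  {Ψ : (quasiSplit (Fp L) L (IsCMField.complexConj L) (2 + 2)).Adelic ≃ₜ* HA L e dV hdV dW hdW}
  (hΨ : ∀ g : (quasiSplit (Fp L) L (IsCMField.complexConj L) (2 + 2)).Adelic,
      (((Ψ g : HA L e dV hdV dW hdW) : GL (Fin (2 + 2)) (AdeleRing (𝓞 L) L)) : Matrix (Fin (2 + 2)) (Fin (2 + 2)) (AdeleRing (𝓞 L) L)) =
        (SA : Matrix (Fin (2 + 2)) (Fin (2 + 2)) (AdeleRing (𝓞 L) L)) *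
          ((adelicVal (Fp L) L (IsCMField.complexConj L) (2 + 2) _ g : GL (Fin (2 + 2)) (AdeleRing (𝓞 L) L)) :
            Matrix (Fin (2 + 2)) (Fin (2 + 2)) (AdeleRing (𝓞 L) L)) *
          ((SA⁻¹ : GL (Fin (2 + 2)) (AdeleRing (𝓞 L) L)) : Matrix (Fin (2 + 2)) (Fin (2 + 2)) (AdeleRing (𝓞 L) L)))

/-- **ALONG EACH FIBRE `z ↦ β₁(Φ(z; y, t))` IS A `Λ`-COVERING WEIGHT ON `𝔸_L`**: `Σ_{l ∈ Λ} β₁(Φ(l + z; y, t)) = Σ_{γ ∈ Γ₁} β₁(γ · Φ(z; y, t)) = 1`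
(the bijection `Λ ≃ Γ₁`, `l ↦ Ψ(u₊(l))`, from the membership law `hΓΛ`). [cite: Weil1965, §9] [cite: MoeglinWaldspurger1995, II.1.7] -/
theorem coveringSum_fibre_eq_one (Y : AddSubgroup (AdeleRing (𝓞 L) L)) (hY : ∀ y, y ∈ Y ↔ conjAdele (Fp L) L (IsCMField.complexConj L) y = -y)
    (Λ : AddSubgroup (AdeleRing (𝓞 L) L)) (Γ₁ : Subgroup ↥(klingenUnipA Ψ))
    (hΓΛ : ∀ γ : ↥(klingenUnipA Ψ), γ ∈ Γ₁ ↔ ∃ l ∈ Λ, (γ : HA L e dV hdV dW hdW) = Ψ (jAdelic L 4 (uPlus (AdeleRing (𝓞 L) L) (conjAdele (Fp L) L (IsCMField.complexConj L)) (conjAdele_conjAdele' L) (l))))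
    {β₁ : ↥(klingenUnipA Ψ) → ℝ≥0∞} (hβ₁ : ∀ x, coveringSum ↥Γ₁ β₁ x = 1) (p : ↥Y × AdeleRing (𝓞 L) L) (z : AdeleRing (𝓞 L) L) :
    coveringSum (Multiplicative ↥Λ) (fun z' : AdeleRing (𝓞 L) L => β₁ ((⟨Ψ (jAdelic L 4 (nKlingen (AdeleRing (𝓞 L) L) (conjAdele (Fp L) L (IsCMField.complexConj L)) (conjAdele_conjAdele' L)
            ((p).1 : AdeleRing (𝓞 L) L) ((hY _).1 (p).1.2) (z') (p).2)), transport_nKlingen_mem Ψ _ _ _ _⟩ : ↥(klingenUnipA Ψ)))) z = 1 := by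
  -- the bijection `Λ ≃ Γ₁`
  have hmem : ∀ l : ↥Λ, (⟨Ψ (jAdelic L 4 (uPlus (AdeleRing (𝓞 L) L) (conjAdele (Fp L) L (IsCMField.complexConj L)) (conjAdele_conjAdele' L) ((l : AdeleRing (𝓞 L) L)))), (mem_klingenUnipA_iff Ψ _).2 ⟨0, skew_zero, (l : AdeleRing (𝓞 L) L), 0, by rw [uPlus_eq_nKlingen]⟩⟩ : ↥(klingenUnipA Ψ)) ∈ Γ₁ :=
    fun l => (hΓΛ _).2 ⟨l, l.2, rfl⟩
  have hinj : Function.Injective fun l : Multiplicative ↥Λ => (⟨_, hmem l.toAdd⟩ : ↥Γ₁) := by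
    intro l l' h
    have h1 := congrArg (fun γ : ↥Γ₁ => ((γ : ↥(klingenUnipA Ψ)) : HA L e dV hdV dW hdW)) h
    simp only at h1
    have h2 := (jAdelic L 4).injective (Ψ.injective h1)
    rw [uPlus_eq_nKlingen, uPlus_eq_nKlingen] at h2
    have h3 := (nKlingen_injective (conjAdele_conjAdele' L) h2).2.1
    exact Multiplicative.toAdd.injective (Subtype.ext h3)
  have hsurj : Function.Surjective fun l : Multiplicative ↥Λ => (⟨_, hmem l.toAdd⟩ : ↥Γ₁) := by
    rintro ⟨γ, hγ⟩
    obtain ⟨l, hl, hγl⟩ := (hΓΛ γ).1 hγ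
    exact ⟨Multiplicative.ofAdd ⟨l, hl⟩, Subtype.ext (Subtype.ext hγl.symm)⟩
  rw [coveringSum, ← hβ₁ ((⟨Ψ (jAdelic L 4 (nKlingen (AdeleRing (𝓞 L) L) (conjAdele (Fp L) L (IsCMField.complexConj L)) (conjAdele_conjAdele' L)
            ((p).1 : AdeleRing (𝓞 L) L) ((hY _).1 (p).1.2) (z) (p).2)), transport_nKlingen_mem Ψ _ _ _ _⟩ : ↥(klingenUnipA Ψ))), coveringSum,
    ← (Equiv.ofBijective _ ⟨hinj, hsurj⟩).tsum_eq]
  refine tsum_congr fun l => congrArg β₁ (Subtype.ext ?_)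
  rw [Subgroup.smul_def, smul_eq_mul, Subgroup.coe_mul, Equiv.ofBijective_apply]
  exact (transport_uPlus_mul_klingenChart Ψ Y hY _ z p).symm

include hΨ in
/-- **(Q2) F5-l — THE FIBRE MASS IS CONSTANT**: `∫⁻ β₁(Φ(z, p)) dμ_Z(z) = ∫⁻ β₁(Φ(z, p₀)) dμ_Z(z)` for all `p, p₀ ∈ Y × 𝔸_L`, `μ_Z` any left-invariant measure on `𝔸_L`,
`β₁` any `Γ₁`-covering weight — ★ F5-e `klingenInner_eq_mul_integral_fibre`'s `hfib` with `C := ∫⁻ β₁(Φ(z, p₀)) dμ_Z`. [cite: Weil1965, §9, §37] [cite: MoeglinWaldspurger1995, II.1.7] -/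
theorem lintegral_fibre_klingenChart_eq [MeasurableSpace (AdeleRing (𝓞 L) L)] [BorelSpace (AdeleRing (𝓞 L) L)] [SecondCountableTopology (AdeleRing (𝓞 L) L)]
    [MeasurableSpace ↥(klingenUnipA Ψ)] [BorelSpace ↥(klingenUnipA Ψ)]
    (Y : AddSubgroup (AdeleRing (𝓞 L) L)) (hY : ∀ y, y ∈ Y ↔ conjAdele (Fp L) L (IsCMField.complexConj L) y = -y)
    (Λ : AddSubgroup (AdeleRing (𝓞 L) L)) [Countable ↥Λ] (Γ₁ : Subgroup ↥(klingenUnipA Ψ))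
    (hΓΛ : ∀ γ : ↥(klingenUnipA Ψ), γ ∈ Γ₁ ↔ ∃ l ∈ Λ, (γ : HA L e dV hdV dW hdW) = Ψ (jAdelic L 4 (uPlus (AdeleRing (𝓞 L) L) (conjAdele (Fp L) L (IsCMField.complexConj L)) (conjAdele_conjAdele' L) (l))))
    {β₁ : ↥(klingenUnipA Ψ) → ℝ≥0∞} (hβ₁ : IsCoveringWeight ↥Γ₁ β₁) (μZ : Measure (AdeleRing (𝓞 L) L)) [μZ.IsAddLeftInvariant] (p p₀ : ↥Y × AdeleRing (𝓞 L) L) :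
    ∫⁻ z, β₁ ((⟨Ψ (jAdelic L 4 (nKlingen (AdeleRing (𝓞 L) L) (conjAdele (Fp L) L (IsCMField.complexConj L)) (conjAdele_conjAdele' L)
            ((p).1 : AdeleRing (𝓞 L) L) ((hY _).1 (p).1.2) (z) (p).2)), transport_nKlingen_mem Ψ _ _ _ _⟩ : ↥(klingenUnipA Ψ))) ∂μZ = ∫⁻ z, β₁ ((⟨Ψ (jAdelic L 4 (nKlingen (AdeleRing (𝓞 L) L) (conjAdele (Fp L) L (IsCMField.complexConj L)) (conjAdele_conjAdele' L)
            ((p₀).1 : AdeleRing (𝓞 L) L) ((hY _).1 (p₀).1.2) (z) (p₀).2)), transport_nKlingen_mem Ψ _ _ _ _⟩ : ↥(klingenUnipA Ψ))) ∂μZ := by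
  haveI : Countable (Multiplicative ↥Λ) := inferInstanceAs (Countable ↥Λ)
  haveI : MeasurableConstSMul (Multiplicative ↥Λ) (AdeleRing (𝓞 L) L) := ⟨fun l => measurable_const_add ((Multiplicative.toAdd l : ↥Λ) : AdeleRing (𝓞 L) L)⟩
  haveI : SMulInvariantMeasure (Multiplicative ↥Λ) (AdeleRing (𝓞 L) L) μZ :=
    ⟨fun l s _hs => by
      rw [show (fun x : AdeleRing (𝓞 L) L => l • x) ⁻¹' s = (fun x => ((Multiplicative.toAdd l : ↥Λ) : AdeleRing (𝓞 L) L) + x) ⁻¹' s from rfl, measure_preimage_add]⟩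
  haveI : SecondCountableTopology ↥Y := TopologicalSpace.Subtype.secondCountableTopology (Y : Set (AdeleRing (𝓞 L) L))
  have hΦc := continuous_klingenChart Ψ hΨ Y hY
  have h := lintegral_mul_eq_of_coveringSum_eq μZ (Γ := Multiplicative ↥Λ) (F := fun _ => (1 : ℝ≥0∞)) measurable_const (fun _ _ => rfl)
    (hβ₁.1.comp (hΦc.measurable.comp (measurable_id.prodMk (measurable_const (a := p)))))
    (hβ₁.1.comp (hΦc.measurable.comp (measurable_id.prodMk (measurable_const (a := p₀))))) one_ne_zero ENNReal.one_ne_top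
    (fun z => coveringSum_fibre_eq_one Y hY Λ Γ₁ hΓΛ hβ₁.2 p z) (fun z => coveringSum_fibre_eq_one Y hY Λ Γ₁ hΓΛ hβ₁.2 p₀ z)
  simpa only [one_mul, Function.comp_def, id_eq] using h

include hΨ in
/-- **… and equals the mass of ANY measurable `Λ`-covering weight `β₀` on `𝔸_L`** (`Σ_{l ∈ Λ} β₀(l + z) = 1`): `∫⁻ β₁(Φ(z,p)) dμ_Z = ∫⁻ β₀ dμ_Z` — so ★ F5-e's `hfib` holds with
`C = ∫⁻ β₀ dμ_Z`, finite as soon as one weight of finite mass exists (`L\𝔸_L` compact). [cite: Weil1965, §9] [cite: CogdellAnalyticTheory2004, §2.3] -/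
theorem lintegral_fibre_klingenChart_eq_of_weight [MeasurableSpace (AdeleRing (𝓞 L) L)] [BorelSpace (AdeleRing (𝓞 L) L)] [SecondCountableTopology (AdeleRing (𝓞 L) L)]
    [MeasurableSpace ↥(klingenUnipA Ψ)] [BorelSpace ↥(klingenUnipA Ψ)]
    (Y : AddSubgroup (AdeleRing (𝓞 L) L)) (hY : ∀ y, y ∈ Y ↔ conjAdele (Fp L) L (IsCMField.complexConj L) y = -y)
    (Λ : AddSubgroup (AdeleRing (𝓞 L) L)) [Countable ↥Λ] (Γ₁ : Subgroup ↥(klingenUnipA Ψ))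
    (hΓΛ : ∀ γ : ↥(klingenUnipA Ψ), γ ∈ Γ₁ ↔ ∃ l ∈ Λ, (γ : HA L e dV hdV dW hdW) = Ψ (jAdelic L 4 (uPlus (AdeleRing (𝓞 L) L) (conjAdele (Fp L) L (IsCMField.complexConj L)) (conjAdele_conjAdele' L) (l))))
    {β₁ : ↥(klingenUnipA Ψ) → ℝ≥0∞} (hβ₁ : IsCoveringWeight ↥Γ₁ β₁) (μZ : Measure (AdeleRing (𝓞 L) L)) [μZ.IsAddLeftInvariant]
    {β₀ : AdeleRing (𝓞 L) L → ℝ≥0∞} (hβ₀m : Measurable β₀) (hβ₀ : ∀ z, ∑' l : ↥Λ, β₀ ((l : AdeleRing (𝓞 L) L) + z) = 1) (p : ↥Y × AdeleRing (𝓞 L) L) :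
    ∫⁻ z, β₁ ((⟨Ψ (jAdelic L 4 (nKlingen (AdeleRing (𝓞 L) L) (conjAdele (Fp L) L (IsCMField.complexConj L)) (conjAdele_conjAdele' L)
            ((p).1 : AdeleRing (𝓞 L) L) ((hY _).1 (p).1.2) (z) (p).2)), transport_nKlingen_mem Ψ _ _ _ _⟩ : ↥(klingenUnipA Ψ))) ∂μZ = ∫⁻ z, β₀ z ∂μZ := by
  haveI : Countable (Multiplicative ↥Λ) := inferInstanceAs (Countable ↥Λ)
  haveI : MeasurableConstSMul (Multiplicative ↥Λ) (AdeleRing (𝓞 L) L) := ⟨fun l => measurable_const_add ((Multiplicative.toAdd l : ↥Λ) : AdeleRing (𝓞 L) L)⟩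
  haveI : SMulInvariantMeasure (Multiplicative ↥Λ) (AdeleRing (𝓞 L) L) μZ :=
    ⟨fun l s _hs => by
      rw [show (fun x : AdeleRing (𝓞 L) L => l • x) ⁻¹' s = (fun x => ((Multiplicative.toAdd l : ↥Λ) : AdeleRing (𝓞 L) L) + x) ⁻¹' s from rfl, measure_preimage_add]⟩
  haveI : SecondCountableTopology ↥Y := TopologicalSpace.Subtype.secondCountableTopology (Y : Set (AdeleRing (𝓞 L) L))
  have hΦc := continuous_klingenChart Ψ hΨ Y hY
  have hcov₀ : ∀ z, coveringSum (Multiplicative ↥Λ) β₀ z = 1 := fun z => by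
    rw [coveringSum, ← Multiplicative.ofAdd.tsum_eq]
    exact hβ₀ z
  have h := lintegral_mul_eq_of_coveringSum_eq μZ (Γ := Multiplicative ↥Λ) (F := fun _ => (1 : ℝ≥0∞)) measurable_const (fun _ _ => rfl)
    (hβ₁.1.comp (hΦc.measurable.comp (measurable_id.prodMk (measurable_const (a := p))))) hβ₀m one_ne_zero ENNReal.one_ne_top
    (fun z => coveringSum_fibre_eq_one Y hY Λ Γ₁ hΓΛ hβ₁.2 p z) hcov₀
  simpa only [one_mul, Function.comp_def, id_eq] using h

end Transport

end Summit.HodgeConjecture.HodgeConjecture.Cruxes.HLiu418.K2LiuKlingenFibreMassConstant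

end
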